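import Summits.BirchSwinnertonDyer.Rank1Residual.X1.GeneratorCountLayerZero
import Summits.BirchSwinnertonDyer.Rank1Residual.Additive.RationalClassesToLayerZero
import Literature.NumberTheory.EllipticCurves.IwasawaSelmerControlKernelCardProofs
import HarnessLib

/-!
# Route M's generator COUNT, VI (V80): the LOSSY counts at members WITH rational `p`-torsion —
# `#ker(H¹(K,E[p]) → H¹(K,E[p^∞])) ≤ #E(K)[p^∞]`, `#ker h_0 = #E(K)[p^∞]`, so a family of `p^B`
# admissible classes still gives `p^B / #E(K)[p^∞]²` classes counted by `X/𝔪X`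
# (cell `b2b-bsdres`, unit `b2b-bsdres-eisenstein-p1`, gen 16; X1R0-GAPMAP §24.2 "δ = 1", V80)

HONEST FRAMING (run/shared/lean/b2b/bsd-rank1-residual/, verbatim in every file): the goal of the
cell is to DELETE the COMBINATION-SHAPED residual classes of the Birch–Swinnerton-Dyer formula for
ALL analytic-rank `≤ 1` elliptic curves over `ℚ` — "full BSD formula for every rank `≤ 1` curve in
class `C`" assembled STRICTLY from published theorems — so that the rank-`≤ 1` remainder becomes
exactly the CONSTRUCTION-SHAPED classes, which are TYPED (missing-input `Prop`s), NOT attempted.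
This is not "finishing BSD". Sub-cell `b2b-bsdres-eisenstein-p1`: research route; NO CLAIM BEYOND
STATED CLASSES; nothing here changes a label; nothing is booked. THEOREMS ONLY (no `def`, no named
fact, nothing asserted); pure Galois-cohomology bookkeeping over any field / number field `K`.

What. FILES 1–5 of the count (`GeneratorCountLayerZero/Tamagawa/Anomalous/AnomalousTwo/Leaf`)
assume `E(K)[p] = 0` (`hK`, on the leaf `p ∤ #E(ℚ)_tors`) TWICE: for the injectivity of
`Ψ = (E[p] ↪ E[p^∞])_* : H¹(K, E[p]) → H¹(K, E[p^∞])` (n1011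
`Additive.exists_finset_torsion_selmerInftyPreimage_zero_card_eq`) and of
`h_0 : H¹(K, E[p^∞]) → H¹(K_∞, E[p^∞])` (`GeneratorCountLayerZero` §2). At the 305 route-M closures
of record binding at a member WITH a rational `p`-torsion point (X1R0-GAPMAP §24.2, "δ = 1") both
maps have kernels, of order `≤ #B_K` where `B_K = E[p^∞]^{Γ_K} = E(K)[p^∞]`:
* §1 `natCard_ker_torsionToPrimaryH1_le` — **`#ker Ψ ≤ #B_K`**: a class `[φ]` in the kernel has
  `ι ∘ φ = ∂a`, `a ∈ E[p^∞]`, with `p a ∈ B_K`, and `[φ] ↦ p a` is INJECTIVE (`p a = p a'` forces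
  `a − a' ∈ E[p]` and `φ − φ' = ∂(a − a')` in `E[p]`) — the Kummer piece
  `E(K)[p^∞]/p ↪ H¹(K, E[p])` of Greenberg LNM 1716 §5 p. 114 as a COUNT;
* §2 `exists_finset_torsion_selmerInftyPreimage_zero_card_mul_le` — hence n1011's level-`0` count
  WITHOUT `hK`: a finite subgroup `S` of admissible classes gives a finite `s ⊆ A_0[p]` with
  `#S ≤ #s · #B_K` (fibres of `Ψ|_S` embed in `ker Ψ`);
* §3 `card_le_natCard_quotient_maximalIdeal_mul_natCard_ker` — `GeneratorCountLayerZero` §2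
  WITHOUT `hK`: `#t ≤ #(X/𝔪X) · #ker h_0` for every finite `t ⊆ A_0[p]` (fibres of `h_0|_t` embed
  in `ker h_0`; the images are `p`-torsion `Γ`-fixed classes of `Sel_∞`, counted by §1 there);
* §4 `natCard_ker_layerToInfty_zero_eq` — **`#ker h_0 = #B_K`** when `E(K_∞)[p^∞]` is finite: the
  tree's `natCard_ker_layerToInfty_eq_natCard_fixedPoints` (Greenberg Lemma 3.1/4.3:
  `ker h_0 = H¹(Γ, E(K_∞)[p^∞])`, of order `#H⁰ = #E(K)[p^∞]`) at `n = 0`.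
The assembly over `ℚ` (count `B = t₀ + a − 2k`, `p^k = #E(ℚ)[p^∞]`; at a `δ = 1` member `a = 2` for
free, the rational `p`-torsion point being a `ℚ_p`-point of order `p`) is FILE VII.

References: [GreenbergLNM1716] §3 Lemma 3.1 (pp. 85–86), §4 Lemma 4.3 (p. 103), §5 p. 114;
X1R0-GAPMAP §14.1, §24.2, §25.
-/

noncomputable section

open scoped Classical

open WeierstrassCurve Literature.NumberTheory.EllipticCurves
  Literature.NumberTheory.GaloisRepresentations Literature.NumberTheory.EllipticCurves.IwasawaAlgebra
  IsLocalRing NumberField IsDedekindDomain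

set_option autoImplicit false

universe u

namespace Summit.BirchSwinnertonDyer.Rank1Residual.X1.GeneratorCountTorsion

/-! ## §1. `#ker (H¹(K, E[p]) → H¹(K, E[p^∞])) ≤ #E[p^∞]^{Γ_K}` -/

section KerPsi

variable {K : Type u} [Field K] (W : WeierstrassCurve K) (p : ℕ)

/-- **`ker Ψ ↪ E[p^∞]^{Γ_K}`** for `Ψ = (E[p] ↪ E[p^∞])_* : H¹(K, E[p]) → H¹(K, E[p^∞])`: for
`[φ] ∈ ker Ψ` write `ι ∘ φ = ∂a` (`a ∈ E[p^∞]`); then `p a` is `Γ_K`-fixed (`p ι(φ σ) = 0`), and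
`[φ] ↦ p a` is INJECTIVE (`p a = p a'` gives `a − a' ∈ E[p]` and `φ − φ' = ∂(a − a')` inside
`E[p]`) — the Kummer piece `E(K)[p^∞]/p E(K)[p^∞] ↪ H¹(K, E[p])` of the cohomology sequence of
`0 → E[p] → E[p^∞] →(p) E[p^∞] → 0` (Greenberg LNM 1716 §5 p. 114), as an injection of sets.
[cite: GreenbergLNM1716, §5 p. 114 (proof of Prop. 5.8)] -/
theorem exists_injective_ker_torsionToPrimaryH1 :
    ∃ F : (torsionToPrimaryH1 W p).ker →
      {a : geomPrimaryTorsion W p // ∀ σ : Field.absoluteGaloisGroup K, σ • a = a},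
      Function.Injective F := by
  -- for `y ∈ ker Ψ`: a cocycle `φ` and `a ∈ E[p^∞]` with `ι ∘ φ = ∂a`
  have key : ∀ y : (torsionToPrimaryH1 W p).ker,
      ∃ (φ : contOneCocycles (discreteTopRep (Field.absoluteGaloisGroup K) (geomTorsion W (p : ℤ))))
        (a : geomPrimaryTorsion W p), oneCocycleClass _ φ = (y : galH1Torsion W (p : ℤ)) ∧
        ∀ σ : Field.absoluteGaloisGroup K,
          AddSubgroup.inclusion (geomTorsion_le_geomPrimaryTorsion W p) (φ.1 σ) = σ • a - a := by
    intro y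
    obtain ⟨φ, hφ⟩ := oneCocycleClass_surjective _ (y : galH1Torsion W (p : ℤ))
    have hy : torsionToPrimaryH1 W p (oneCocycleClass _ φ) = 0 := by rw [hφ]; exact y.2
    rw [torsionToPrimaryH1_oneCocycleClass, oneCocycleClass_eq_zero_iff] at hy
    obtain ⟨a, ha⟩ := hy
    exact ⟨φ, a, hφ, fun σ ↦ ha σ⟩
  choose φ a hφ ha using key
  -- pointwise `p • φ σ = 0`
  have hpφ : ∀ (y : (torsionToPrimaryH1 W p).ker) (σ : Field.absoluteGaloisGroup K),
      p • (φ y).1 σ = 0 := fun y σ ↦ by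
    apply Subtype.ext
    rw [AddSubgroupClass.coe_nsmul, ZeroMemClass.coe_zero]
    exact AddSubgroup.torsionBy.nsmul_iff.mp ((φ y).1 σ).2
  -- `p • a` is `Γ_K`-fixed
  have hfix : ∀ (y : (torsionToPrimaryH1 W p).ker) (σ : Field.absoluteGaloisGroup K),
      σ • (p • a y) = p • a y := fun y σ ↦ by
    rw [← sub_eq_zero, smul_comm, ← smul_sub, ← ha y σ, ← map_nsmul, hpφ y σ, map_zero]
  refine ⟨fun y ↦ ⟨p • a y, hfix y⟩, fun y₁ y₂ h ↦ ?_⟩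
  have hpa : p • a y₁ = p • a y₂ := congrArg Subtype.val h
  -- `a y₁ - a y₂ ∈ E[p]`
  have hmem : ((a y₁ - a y₂ : geomPrimaryTorsion W p) : geomPoints W) ∈ geomTorsion W (p : ℤ) :=
    AddSubgroup.torsionBy.nsmul_iff.mpr (by
      rw [← AddSubgroupClass.coe_nsmul, smul_sub, hpa, sub_self, ZeroMemClass.coe_zero])
  -- `φ y₁ - φ y₂ = ∂ (a y₁ - a y₂)` in `E[p]`
  apply Subtype.ext
  rw [← hφ y₁, ← hφ y₂, ← sub_eq_zero, ← oneCocycleClass_sub, oneCocycleClass_eq_zero_iff]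
  refine ⟨⟨_, hmem⟩, fun σ ↦ ?_⟩
  apply AddSubgroup.inclusion_injective (geomTorsion_le_geomPrimaryTorsion W p)
  have e : (φ y₁ - φ y₂).1 σ = (φ y₁).1 σ - (φ y₂).1 σ := rfl
  rw [e, map_sub, ha y₁ σ, ha y₂ σ, map_sub]
  change σ • a y₁ - a y₁ - (σ • a y₂ - a y₂) =
    σ • (AddSubgroup.inclusion (geomTorsion_le_geomPrimaryTorsion W p) ⟨_, hmem⟩) -
      AddSubgroup.inclusion (geomTorsion_le_geomPrimaryTorsion W p) ⟨_, hmem⟩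
  have e2 : AddSubgroup.inclusion (geomTorsion_le_geomPrimaryTorsion W p) ⟨_, hmem⟩ = a y₁ - a y₂ :=
    rfl
  rw [e2, smul_sub]
  abel

/-- `ker Ψ` is finite as soon as `E[p^∞]^{Γ_K}` is (e.g. over a number field: `E(K)_{tors}` is
finite). [cite: GreenbergLNM1716, §5 p. 114] -/
theorem finite_ker_torsionToPrimaryH1
    (hfin : Set.Finite {a : geomPrimaryTorsion W p | ∀ σ : Field.absoluteGaloisGroup K, σ • a = a}) :
    Finite (torsionToPrimaryH1 W p).ker := by
  haveI : Finite {a : geomPrimaryTorsion W p // ∀ σ : Field.absoluteGaloisGroup K, σ • a = a} :=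
    hfin.to_subtype
  obtain ⟨F, hF⟩ := exists_injective_ker_torsionToPrimaryH1 W p
  exact Finite.of_injective F hF

/-- **`#ker Ψ ≤ #E[p^∞]^{Γ_K}`** (`= #E(K)[p^∞]`). [cite: GreenbergLNM1716, §5 p. 114] -/
theorem natCard_ker_torsionToPrimaryH1_le
    (hfin : Set.Finite {a : geomPrimaryTorsion W p | ∀ σ : Field.absoluteGaloisGroup K, σ • a = a}) :
    Nat.card (torsionToPrimaryH1 W p).ker ≤
      Nat.card {a : geomPrimaryTorsion W p // ∀ σ : Field.absoluteGaloisGroup K, σ • a = a} := by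
  haveI : Finite {a : geomPrimaryTorsion W p // ∀ σ : Field.absoluteGaloisGroup K, σ • a = a} :=
    hfin.to_subtype
  obtain ⟨F, hF⟩ := exists_injective_ker_torsionToPrimaryH1 W p
  exact Nat.card_le_card_of_injective F hF

end KerPsi

/-! ## §2. The level-`0` count from admissible classes, WITHOUT `E(K)[p] = 0` -/

section Counting

variable {K : Type u} [Field K] [NumberField K] (W : WeierstrassCurve K) (p : ℕ) [hp : Fact p.Prime]
  (κ : ZpExtension K p)

/-- **The level-`0` count from a finite subgroup of `H¹(K, E[p])`, LOSSY form** (n1011's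
`Additive.exists_finset_torsion_selmerInftyPreimage_zero_card_eq` without `E(K)[p] = 0`): for a
finite subgroup `S ≤ H¹(K, E[p])` of classes Kummer outside `T` and at `∞` and satisfying the
`K_∞`-level condition on `T`, `A_0[p]` contains a finite set `s` with `#S ≤ #s · #E[p^∞]^{Γ_K}`:
the fibres of `Ψ|_S` (`Ψ` followed by the injective `res` to `κ.layerSubgroup 0 = Γ_K`) are cosets
of `ker Ψ ⊓ S`, of order `≤ #ker Ψ ≤ #E[p^∞]^{Γ_K}` (§1). [cite: GreenbergLNM1716, §3 pp. 85–86 and §5 p. 114] -/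
theorem exists_finset_torsion_selmerInftyPreimage_zero_card_mul_le
    (hBfin : Set.Finite {a : geomPrimaryTorsion W p | ∀ σ : Field.absoluteGaloisGroup K, σ • a = a})
    (S : AddSubgroup (galH1Torsion W (p : ℤ))) [Finite S] (T : Set (HeightOneSpectrum (𝓞 K)))
    (hfin : ∀ y ∈ S, ∀ v : HeightOneSpectrum (𝓞 K), v ∉ T →
      y ∈ selmerLocalKer W (v.adicCompletion K) (p : ℤ))
    (hinf : ∀ y ∈ S, ∀ w : InfinitePlace K, y ∈ selmerLocalKer W w.Completion (p : ℤ))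
    (hT : ∀ y ∈ S, ∀ v ∈ T, W.layerToInfty κ 0
        (resH1Hom (Literature.NumberTheory.EllipticCurves.subgroupIncl (κ.layerSubgroup 0))
          (AddMonoidHom.id (geomPrimaryTorsion W p))
          (fun _ _ ↦ rfl) (torsionToPrimaryH1 W p y)) ∈
        W.localKerOver p κ.kerSubgroup (v.adicCompletion K)) :
    ∃ s : Finset {z : W.selmerInftyPreimage κ 0 // p • z = 0},
      Nat.card S ≤ s.card *
        Nat.card {a : geomPrimaryTorsion W p // ∀ σ : Field.absoluteGaloisGroup K, σ • a = a} := by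
  haveI : Fintype S := Fintype.ofFinite S
  haveI hkfin : Finite (torsionToPrimaryH1 W p).ker := finite_ker_torsionToPrimaryH1 W p hBfin
  have hker := natCard_ker_torsionToPrimaryH1_le W p hBfin
  -- `Ψ₀ : S → A_0[p]` (n1011)
  let f : S → {z : W.selmerInftyPreimage κ 0 // p • z = 0} := fun y ↦
    ⟨⟨resH1Hom (Literature.NumberTheory.EllipticCurves.subgroupIncl (κ.layerSubgroup 0))
        (AddMonoidHom.id (geomPrimaryTorsion W p)) (fun _ _ ↦ rfl) (torsionToPrimaryH1 W p y),
      Additive.resH1Hom_torsionToPrimaryH1_mem_selmerInftyPreimage_zero W p κ y T (hfin y y.2)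
        (hinf y y.2) (hT y y.2)⟩,
      Subtype.ext (by
        rw [AddSubgroup.coe_nsmul, ZeroMemClass.coe_zero]
        exact Additive.smul_resH1Hom_torsionToPrimaryH1_eq_zero W p κ y)⟩
  have hf : ∀ y₁ y₂ : S, f y₁ = f y₂ →
      ((y₁ : galH1Torsion W (p : ℤ)) - y₂) ∈ (torsionToPrimaryH1 W p).ker := by
    intro y₁ y₂ h
    have h' := congrArg (fun z : {z : W.selmerInftyPreimage κ 0 // p • z = 0} ↦
      ((z.1 : W.selmerInftyPreimage κ 0) : W.subgroupH1 p (κ.layerSubgroup 0))) h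
    have h'' : torsionToPrimaryH1 W p y₁ = torsionToPrimaryH1 W p y₂ :=
      Additive.resH1Hom_layerSubgroup_zero_injective W p κ h'
    rw [AddMonoidHom.mem_ker, map_sub, h'', sub_self]
  refine ⟨Finset.univ.image f, ?_⟩
  -- fibres of `f` embed in `ker Ψ`
  have hfib : ∀ b ∈ Finset.univ.image f,
      (Finset.univ.filter fun y : S ↦ f y = b).card ≤ Nat.card (torsionToPrimaryH1 W p).ker := by
    intro b hb
    obtain ⟨y₀, -, rfl⟩ := Finset.mem_image.mp hb
    rw [← Nat.card_eq_finsetCard]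
    refine Nat.card_le_card_of_injective
      (fun y : ↥(Finset.univ.filter fun y : S ↦ f y = f y₀) ↦
        (⟨(y.1 : galH1Torsion W (p : ℤ)) - y₀, hf y.1 y₀ (Finset.mem_filter.mp y.2).2⟩ :
          (torsionToPrimaryH1 W p).ker)) fun y y' h ↦ ?_
    have h1 : ((y.1 : galH1Torsion W (p : ℤ)) - y₀) = (y'.1 : galH1Torsion W (p : ℤ)) - y₀ :=
      congrArg Subtype.val h
    exact Subtype.ext (Subtype.ext (sub_left_injective h1))
  calc Nat.card S = (Finset.univ : Finset S).card := by
        rw [Nat.card_eq_fintype_card, Finset.card_univ]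
    _ ≤ Nat.card (torsionToPrimaryH1 W p).ker * (Finset.univ.image f).card :=
        Finset.card_le_mul_card_image _ _ hfib
    _ ≤ Nat.card {a : geomPrimaryTorsion W p // ∀ σ : Field.absoluteGaloisGroup K, σ • a = a} *
          (Finset.univ.image f).card := Nat.mul_le_mul_right _ hker
    _ = (Finset.univ.image f).card *
          Nat.card {a : geomPrimaryTorsion W p // ∀ σ : Field.absoluteGaloisGroup K, σ • a = a} :=
        mul_comm _ _

end Counting

/-! ## §3. `#A_0[p]`-families are counted by `X/𝔪X` up to `#ker h_0` -/

section LayerZero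

variable {K : Type u} [Field K] [NumberField K] (W : WeierstrassCurve K) {p : ℕ}
  [hp : Fact p.Prime] (κ : ZpExtension K p) {γ : Field.absoluteGaloisGroup K}
  (D : W.SelmerDualData κ γ)

/-- **`#t ≤ #(X/𝔪X) · #ker h_0` for every finite `t ⊆ A_0[p]`, with NO hypothesis on `E(K)[p]`**
(`GeneratorCountLayerZero.card_le_natCard_quotient_maximalIdeal_of_layerZeroClasses`, lossy form):
the fibres of `h_0|_t` embed in `ker h_0`, and the images `h_0 z` are DISTINCT `p`-torsion `Γ`-fixed
classes of `Sel_∞` (`im h_0 ⊆ H¹(K_∞, E[p^∞])^Γ`, `κ.layerSubgroup 0 = ⊤`), counted by `X/𝔪X`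
(`GeneratorCountLayerZero.card_le_natCard_quotient_maximalIdeal`).
[cite: GreenbergLNM1716, §1 p. 60 and §3 pp. 85–86 (Lemma 3.1)] -/
theorem card_le_natCard_quotient_maximalIdeal_mul_natCard_ker [W.IsElliptic]
    [Module.Finite (IwasawaAlgebra p) D.X] [Finite (W.layerToInfty κ 0).ker]
    (t : Finset {z : W.selmerInftyPreimage κ 0 // p • z = 0}) :
    t.card ≤ Nat.card (D.X ⧸ maximalIdeal (IwasawaAlgebra p) •
      (⊤ : Submodule (IwasawaAlgebra p) D.X)) * Nat.card (W.layerToInfty κ 0).ker := by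
  -- `g z = h_0 z ∈ Sel_∞`
  let g : {z : W.selmerInftyPreimage κ 0 // p • z = 0} → W.selmerInfty κ :=
    fun z ↦ ⟨W.layerToInfty κ 0 (z.1 : W.subgroupH1 p (κ.layerSubgroup 0)), z.1.2⟩
  have hg_coe : ∀ z, ((g z : W.selmerInfty κ) : W.subgroupH1 p κ.kerSubgroup) =
      W.layerToInfty κ 0 (z.1 : W.subgroupH1 p (κ.layerSubgroup 0)) := fun _ ↦ rfl
  -- fibres of `g` embed in `ker h_0`
  have hg : ∀ z z' : {z : W.selmerInftyPreimage κ 0 // p • z = 0}, g z = g z' →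
      ((z.1 : W.subgroupH1 p (κ.layerSubgroup 0)) - z'.1) ∈ (W.layerToInfty κ 0).ker := by
    intro z z' h
    have h' := congrArg (fun s : W.selmerInfty κ ↦ (s : W.subgroupH1 p κ.kerSubgroup)) h
    simp only [hg_coe] at h'
    rw [AddMonoidHom.mem_ker, map_sub, h', sub_self]
  have hfib : ∀ b ∈ t.image g,
      (t.filter fun z ↦ g z = b).card ≤ Nat.card (W.layerToInfty κ 0).ker := by
    intro b hb
    obtain ⟨z₀, -, rfl⟩ := Finset.mem_image.mp hb
    rw [← Nat.card_eq_finsetCard]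
    refine Nat.card_le_card_of_injective
      (fun z : ↥(t.filter fun z ↦ g z = g z₀) ↦
        (⟨(z.1.1 : W.subgroupH1 p (κ.layerSubgroup 0)) - z₀.1, hg z.1 z₀ (Finset.mem_filter.mp z.2).2⟩ :
          (W.layerToInfty κ 0).ker)) fun z z' h ↦ ?_
    have h1 : ((z.1.1 : W.subgroupH1 p (κ.layerSubgroup 0)) - z₀.1) =
        (z'.1.1 : W.subgroupH1 p (κ.layerSubgroup 0)) - z₀.1 := congrArg Subtype.val h
    exact Subtype.ext (Subtype.ext (Subtype.ext (sub_left_injective h1)))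
  -- the images are `p`-torsion and `Γ`-fixed
  have himg : ∀ s ∈ t.image g,
      p • s = 0 ∧ W.conjH1 p κ.kerSubgroup γ (s : W.subgroupH1 p κ.kerSubgroup) = s := by
    intro s hs
    obtain ⟨z, -, rfl⟩ := Finset.mem_image.mp hs
    refine ⟨?_, ?_⟩
    · apply Subtype.ext
      have hz : ((p • z.1 : W.selmerInftyPreimage κ 0) : W.subgroupH1 p (κ.layerSubgroup 0)) = 0 := by
        rw [z.2]; rfl
      change p • W.layerToInfty κ 0 (z.1 : W.subgroupH1 p (κ.layerSubgroup 0)) = 0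
      rw [← map_nsmul, ← AddSubgroup.coe_nsmul, hz, map_zero]
    · have hmem : W.layerToInfty κ 0 (z.1 : W.subgroupH1 p (κ.layerSubgroup 0)) ∈
          W.layerInvariants κ 0 :=
        W.range_layerToInfty_le_layerInvariants_holds κ 0 ⟨_, rfl⟩
      rw [mem_layerInvariants_iff] at hmem
      exact hmem γ (by rw [ZpExtension.layerSubgroup_zero]; exact Subgroup.mem_top γ)
  calc t.card ≤ Nat.card (W.layerToInfty κ 0).ker * (t.image g).card :=
        Finset.card_le_mul_card_image _ _ hfib
    _ ≤ Nat.card (W.layerToInfty κ 0).ker * Nat.card (D.X ⧸ maximalIdeal (IwasawaAlgebra p) •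
          (⊤ : Submodule (IwasawaAlgebra p) D.X)) :=
        Nat.mul_le_mul_left _ (GeneratorCountLayerZero.card_le_natCard_quotient_maximalIdeal D _ himg)
    _ = _ := mul_comm _ _

/-! ## §4. `#ker h_0 = #E[p^∞]^{Γ_K}`, and the lossy count assembled -/

omit [NumberField K] in
/-- The `Γ_K`-fixed points of `E[p^∞]` lie in `E[p^∞]^{Gal(K̄/K_∞)}`, so are finite when the latter
is. [folklore] -/
theorem finite_fixedPoints_of_finite_fixedPoints_kerSubgroup
    [Finite (FixedPoints.addSubgroup κ.kerSubgroup (geomPrimaryTorsion W p))] :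
    Set.Finite {a : geomPrimaryTorsion W p | ∀ σ : Field.absoluteGaloisGroup K, σ • a = a} := by
  refine (Set.finite_coe_iff.mp ‹Finite (FixedPoints.addSubgroup κ.kerSubgroup
    (geomPrimaryTorsion W p))›).subset fun a ha ↦ ?_
  exact fun σ ↦ ha σ

/-- **`#ker h_0 = #E[p^∞]^{Γ_K}`** (`= #E(K)[p^∞]`) when `E(K_∞)[p^∞]` is finite: the tree's
`natCard_ker_layerToInfty_eq_natCard_fixedPoints` (Greenberg: `ker h_0 = H¹(Γ, E(K_∞)[p^∞])` has
the order of `H⁰(Γ, E(K_∞)[p^∞]) = E(K)[p^∞]`) at `n = 0`, `κ.layerSubgroup 0 = Γ_K`.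
[cite: GreenbergLNM1716, §3 Lemma 3.1 (p. 86) and §4 Lemma 4.3 (p. 103)] -/
theorem natCard_ker_layerToInfty_zero_eq
    [Finite (FixedPoints.addSubgroup κ.kerSubgroup (geomPrimaryTorsion W p))] :
    Nat.card (W.layerToInfty κ 0).ker =
      Nat.card {a : geomPrimaryTorsion W p // ∀ σ : Field.absoluteGaloisGroup K, σ • a = a} := by
  rw [W.natCard_ker_layerToInfty_eq_natCard_fixedPoints κ 0]
  exact Nat.card_congr (Equiv.subtypeEquivRight fun m ↦
    ⟨fun h σ ↦ h σ (by rw [ZpExtension.layerSubgroup_zero]; exact Subgroup.mem_top σ),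
      fun h σ _ ↦ h σ⟩)

/-- `ker h_0` is finite when `E(K_∞)[p^∞]` is. [cite: GreenbergLNM1716, §3 Lemma 3.1 (p. 86)] -/
theorem finite_ker_layerToInfty_zero
    [Finite (FixedPoints.addSubgroup κ.kerSubgroup (geomPrimaryTorsion W p))] :
    Finite (W.layerToInfty κ 0).ker := by
  haveI : Finite {a : geomPrimaryTorsion W p // ∀ σ : Field.absoluteGaloisGroup K, σ • a = a} :=
    (finite_fixedPoints_of_finite_fixedPoints_kerSubgroup W κ).to_subtype
  haveI : Nonempty {a : geomPrimaryTorsion W p // ∀ σ : Field.absoluteGaloisGroup K, σ • a = a} :=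
    ⟨⟨0, fun σ ↦ smul_zero σ⟩⟩
  refine Nat.finite_of_card_ne_zero ?_
  rw [natCard_ker_layerToInfty_zero_eq]
  exact Nat.card_pos.ne'

/-- **THE LOSSY COUNT** (V80): for an elliptic curve over a number field `K`, ANY `ℤ_p`-extension
`κ` with `E(K_∞)[p^∞]` finite, any `γ` and any Pontryagin-dual datum `D` (`X = D.X` f.g.), and a
finite subgroup `S ≤ H¹(K, E[p])` of admissible classes (Kummer off `T` and at `∞`, `K_∞`-condition
on `T`): **`#S ≤ #(X/𝔪X) · (#E[p^∞]^{Γ_K})²`** — §2, then §3 with `#ker h_0 = #E[p^∞]^{Γ_K}`.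
[cite: GreenbergLNM1716, §1 p. 60, §3 pp. 85–86, §5 p. 114] -/
theorem natCard_le_natCard_quotient_maximalIdeal_mul_sq [W.IsElliptic]
    [Module.Finite (IwasawaAlgebra p) D.X]
    [Finite (FixedPoints.addSubgroup κ.kerSubgroup (geomPrimaryTorsion W p))]
    (S : AddSubgroup (galH1Torsion W (p : ℤ))) [Finite S] (T : Set (HeightOneSpectrum (𝓞 K)))
    (hfin : ∀ y ∈ S, ∀ v : HeightOneSpectrum (𝓞 K), v ∉ T →
      y ∈ selmerLocalKer W (v.adicCompletion K) (p : ℤ))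
    (hinf : ∀ y ∈ S, ∀ w : InfinitePlace K, y ∈ selmerLocalKer W w.Completion (p : ℤ))
    (hT : ∀ y ∈ S, ∀ v ∈ T, W.layerToInfty κ 0
        (resH1Hom (Literature.NumberTheory.EllipticCurves.subgroupIncl (κ.layerSubgroup 0))
          (AddMonoidHom.id (geomPrimaryTorsion W p))
          (fun _ _ ↦ rfl) (torsionToPrimaryH1 W p y)) ∈
        W.localKerOver p κ.kerSubgroup (v.adicCompletion K)) :
    Nat.card S ≤ Nat.card (D.X ⧸ maximalIdeal (IwasawaAlgebra p) •
      (⊤ : Submodule (IwasawaAlgebra p) D.X)) *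
      Nat.card {a : geomPrimaryTorsion W p // ∀ σ : Field.absoluteGaloisGroup K, σ • a = a} ^ 2 := by
  haveI := finite_ker_layerToInfty_zero W κ
  have hBfin := finite_fixedPoints_of_finite_fixedPoints_kerSubgroup W κ
  obtain ⟨s, hs⟩ := exists_finset_torsion_selmerInftyPreimage_zero_card_mul_le W p κ hBfin S T hfin
    hinf hT
  have ht := card_le_natCard_quotient_maximalIdeal_mul_natCard_ker W κ D s
  rw [natCard_ker_layerToInfty_zero_eq] at ht
  calc Nat.card S ≤ s.card * _ := hs
    _ ≤ (Nat.card (D.X ⧸ maximalIdeal (IwasawaAlgebra p) • (⊤ : Submodule (IwasawaAlgebra p) D.X)) *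
          Nat.card {a : geomPrimaryTorsion W p // ∀ σ : Field.absoluteGaloisGroup K, σ • a = a}) *
          Nat.card {a : geomPrimaryTorsion W p // ∀ σ : Field.absoluteGaloisGroup K, σ • a = a} :=
        Nat.mul_le_mul_right _ ht
    _ = _ := by ring

end LayerZero

end Summit.BirchSwinnertonDyer.Rank1Residual.X1.GeneratorCountTorsion

end
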